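import Literature.Analysis.FluidPDE.TaoForcedBoundedTotalSpeed
import Literature.Analysis.FluidPDE.TaoForcedFiniteEnergyLerayHopfL2
import HarnessLib

/-!
# Tao 2011, Cor. 11.4 (unconditional uniqueness) WITH FORCE is a THEOREM — discharge of the named
# fact `tao2011_forced_unconditionalUniqueness_velocity` (W14) in its GENERAL force class

Analysis/FluidPDE proof file (no definitions, no named facts, no `sorry`). Cell `pub/ns-blowup`, seat
`ns-blowup-lean` g5. It proves the Literature leaf W14,
`Literature.Analysis.FluidPDE.tao2011_forced_unconditionalUniqueness_velocity`
(`TaoForcedNormalisedPressure.lean`; T. Tao, *Localisation and compactness properties of the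
Navier–Stokes global regularity problem*, Anal. PDE 6 (2013) = arXiv:1108.1165, **Cor. 11.4** = arXiv
Cor. 71, p. 36: "Let `(u₀, f, T)` be smooth `H¹` data. Then there is at most one almost smooth finite
energy solution `(u, p, u₀, f, T)` with this data and with normalised pressure"), in the tree's
rendering: `ν > 0`; a force smooth on the closed slab `[0,T] × ℝ³` with `‖f‖_{L^∞_t H¹_x} < ∞`; two
classical solutions of the forced system with the same `H¹` datum and the same force, both of finite
energy; then the velocities agree on `[0, T]` — the statement of the support item `TaoForcedUniqueness`
(`stmt-NavierStokesRegularity-19180`) of `route-NavierStokesRegularity-PalasekTowerBreakdown`.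
WHAT THIS IS NOT: not a statement about Navier–Stokes blow-up — a uniqueness theorem for smooth
finite-energy solutions of the forced system.

## The chain (Tao's Remark 11.3 WITH force; every link a theorem of the tree)

* Lemma 8.1 WITH force (finite dissipation): `tao2011_forced_finiteEnergy_energyBound_holds`
  (`TaoForcedEnergyBoundDischarge`, seat lit g9), packaged for `L²` force slices as
  `IsClassicalNSSolutionOn.dissipation_lt_top_of_forceL2` (`TaoForcedFiniteEnergyLerayHopfL2`);
* Lemma 8.1 + Lemma 4.1 (i) WITH force (the solutions are Leray–Hopf, energy equality), with NO
  hypothesis on the force potential: `IsClassicalNSSolutionOn.isLerayHopfOn_of_finiteEnergy_forced_L2`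
  (`TaoForcedFiniteEnergyLerayHopfL2`, this seat);
* Prop. 9.1 WITH force (finite total speed): `lintegral_eLpNorm_top_lt_top_forced`
  (`TaoForcedBoundedTotalSpeed`, seat lean2), here fed with the previous two items
  (`IsClassicalNSSolutionOn.totalSpeed_lt_top_of_forceL2`);
* Thm. 10.1 / Cor. 11.1 WITH force (bounded enstrophy, `u ∈ X¹`) and Cor. 4.3 + Thm. 5.4 (iii)
  (uniqueness in `X¹`), assembled as `tao2011_forced_unconditionalUniqueness_velocity_of_totalSpeed`
  (`TaoForcedUniquenessApriori`, seat lean2).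

## Main results

* `IsClassicalNSSolutionOn.totalSpeed_lt_top_of_forceL2` — Prop. 9.1 WITH force for every classical
  finite-energy solution whose force has slices uniformly in `L²` on `[0,T]`;
* **`tao2011_forced_unconditionalUniqueness_velocity_holds : tao2011_forced_unconditionalUniqueness_velocity`**;
* `tao2011_forced_unconditionalUniqueness_velocity_and_pressure` — the printed form (velocities AND
  normalised pressures agree), from the tree's `tao2011_forced_unconditionalUniqueness_of_velocity`.

(The `f = 0` case, `tao_unconditional_uniqueness_velocity`, is already the tree's theorem
`tao_unconditional_uniqueness_velocity_holds`; it also follows from the forced theorem by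
`tao2011_forced_unconditionalUniqueness_velocity.force_zero` — not restated.)

## References

* T. Tao, *Localisation and compactness properties of the Navier–Stokes global regularity
  problem*, Anal. PDE 6 (2013) 25–107 = arXiv:1108.1165 (`Tao2011`): Cor. 11.4 (arXiv Cor. 71,
  p. 36) with Remark 11.3 (arXiv Rem. 70), Cor. 11.1 (arXiv Cor. 68), Prop. 9.1 (arXiv Prop. 52),
  Lemma 8.1 (arXiv Lemma 44), Lemma 4.1 (i) (arXiv Lemma 25 (i)), Def. 1.1 (p. 3).
-/

noncomputable section

open MeasureTheory Set Filter Topology Function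
open scoped ENNReal NNReal RealInnerProductSpace

namespace Literature.Analysis.FluidPDE

section TotalSpeed

variable {T ν : ℝ} {f u : ℝ → EuclideanSpace ℝ (Fin 3) → EuclideanSpace ℝ (Fin 3)}
  {p : ℝ → EuclideanSpace ℝ (Fin 3) → ℝ}

/-- **Tao 2011, Prop. 9.1 (bounded total speed) WITH force, for `L²` force slices.** A classical
solution of the forced system (`ν > 0`) on `[0,T] × ℝ³`, `T > 0`, with finite energy
`sup_t ∫|u(t)|² < ∞` and force slices `∫|f(t)|² ≤ C_f < ∞` has `∫₀ᵀ ‖u(t)‖_{L^∞} dt < ∞`: the tree's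
`lintegral_eLpNorm_top_lt_top_forced` with its Leray–Hopf, `L²_{t,x}`-force and dissipation hypotheses
discharged by `isLerayHopfOn_of_finiteEnergy_forced_L2`, `force_prod_aestronglyMeasurable`,
`force_prod_eLpNorm_two_lt_top`, `dissipation_lt_top_of_forceL2` (no hypothesis on `Δ⁻¹∇·f`).
[cite: Tao2011, Prop. 9.1 (arXiv Prop. 52) with Lemma 8.1 and Lemma 4.1 (i)] -/
theorem IsClassicalNSSolutionOn.totalSpeed_lt_top_of_forceL2
    (h : IsClassicalNSSolutionOn (Icc 0 T) ν f u p) (hν : 0 < ν) (hT : 0 < T)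
    {Cf : ℝ≥0∞} (hCft : Cf ≠ ⊤) (hCf : ∀ t ∈ Icc 0 T, ∫⁻ x, ‖f t x‖ₑ ^ 2 ≤ Cf)
    (hE : ∃ A : ℝ≥0∞, A < ⊤ ∧ ∀ t ∈ Icc 0 T, ∫⁻ x, ‖u t x‖ₑ ^ 2 ≤ A) :
    ∫⁻ t in Ioo 0 T, eLpNorm (u t) ∞ volume < ⊤ :=
  lintegral_eLpNorm_top_lt_top_forced hν hT h (h.isLerayHopfOn_of_finiteEnergy_forced_L2 hν hT hCft hCf hE).1
    (h.force_prod_aestronglyMeasurable hT) (h.force_prod_eLpNorm_two_lt_top hT hCft hCf) hE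
    (h.dissipation_lt_top_of_forceL2 hν hT hCft hCf hE)

end TotalSpeed

/-! ## W14 is a theorem -/

section Uniqueness

/-- **Tao 2011, Cor. 11.4 (Unconditional uniqueness, arXiv Cor. 71) WITH FORCE, velocity form, is a
THEOREM** — discharge of the named fact `tao2011_forced_unconditionalUniqueness_velocity` (W14) in its
own binders: `ν > 0`, `0 < T`, a force smooth on the closed slab `[0,T] × ℝ³` with
`‖f‖_{L^∞_t H¹_x} < ∞`, two classical solutions of the forced system with the same `H¹` datum, both of
finite energy ⇒ the velocities agree on `[0,T]`. Proof = Remark 11.3 WITH force: finite dissipation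
(Lemma 8.1 WITH force, `dissipation_lt_top_of_forceL2` — only the `j = 0` half `sup_t ∫|f(t)|² < ∞` of
the `H¹` hypothesis on the force is used there) and finite total speed (Prop. 9.1 WITH force,
`totalSpeed_lt_top_of_forceL2`) of both solutions, then
`tao2011_forced_unconditionalUniqueness_velocity_of_totalSpeed` (Cor. 11.1 WITH force: both lie in
`X¹`; Cor. 4.3 + Thm. 5.4 (iii): `X¹` solutions with the same datum and force coincide).
[cite: Tao2011, Cor. 11.4 (arXiv Cor. 71, p. 36) + Remark 11.3] -/
theorem tao2011_forced_unconditionalUniqueness_velocity_holds :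
    tao2011_forced_unconditionalUniqueness_velocity := by
  intro ν T hν hT f hf hfH1 u v p q hu hv h₀ hdatum huE hvE
  -- the `j = 0` half of the `H¹` bound on the force: slices uniformly in `L²`
  obtain ⟨C0, hC0⟩ := hfH1 0 (Nat.zero_le 1)
  have hCf : ∀ t ∈ Icc 0 T, ∫⁻ x, ‖f t x‖ₑ ^ 2 ≤ (C0 : ℝ≥0∞) := by
    intro t ht
    have e : (fun x => ‖iteratedFDeriv ℝ 0 (f t) x‖ₑ ^ 2) = fun x => ‖f t x‖ₑ ^ 2 := by
      funext x; rw [← ofReal_norm, norm_iteratedFDeriv_zero, ofReal_norm]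
    have h1 := hC0 t ht
    rw [e] at h1
    exact h1
  -- energies in `ℝ≥0∞` form
  have hE : ∀ {w : ℝ → EuclideanSpace ℝ (Fin 3) → EuclideanSpace ℝ (Fin 3)},
      (∃ C : ℝ≥0, ∀ s ∈ Icc 0 T, ∫⁻ x, ‖w s x‖ₑ ^ 2 ≤ C) →
      ∃ A : ℝ≥0∞, A < ⊤ ∧ ∀ s ∈ Icc 0 T, ∫⁻ x, ‖w s x‖ₑ ^ 2 ≤ A := by
    rintro w ⟨C, hC⟩
    exact ⟨C, ENNReal.coe_lt_top, hC⟩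
  have huD := hu.dissipation_lt_top_of_forceL2 hν hT ENNReal.coe_ne_top hCf (hE huE)
  have hvD := hv.dissipation_lt_top_of_forceL2 hν hT ENNReal.coe_ne_top hCf (hE hvE)
  have huM := hu.totalSpeed_lt_top_of_forceL2 hν hT ENNReal.coe_ne_top hCf (hE huE)
  have hvM := hv.totalSpeed_lt_top_of_forceL2 hν hT ENNReal.coe_ne_top hCf (hE hvE)
  exact tao2011_forced_unconditionalUniqueness_velocity_of_totalSpeed hν hT hf hfH1 hu hv h₀ hdatum huE
    hvE huD hvD huM hvM

/-- **Cor. 11.4 WITH force, as printed** ("at most one … solution … with normalised pressure"): under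
the hypotheses of the velocity form and with BOTH pressures normalised ((9):
`HasForcedNormalisedPressure`), the two solutions coincide on `[0,T] × ℝ³` — velocities AND pressures.
The tree's `tao2011_forced_unconditionalUniqueness_of_velocity` fed with the theorem above.
[cite: Tao2011, Cor. 11.4 (arXiv Cor. 71), p. 36] -/
theorem tao2011_forced_unconditionalUniqueness_velocity_and_pressure {ν T : ℝ} (hν : 0 < ν)
    (hT : 0 < T) {f : ℝ → EuclideanSpace ℝ (Fin 3) → EuclideanSpace ℝ (Fin 3)}
    (hf : IsSmoothSpaceTimeOn (Icc 0 T) f)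
    (hfH1 : ∀ j ≤ 1, ∃ C : ℝ≥0, ∀ t ∈ Icc 0 T, ∫⁻ x, ‖iteratedFDeriv ℝ j (f t) x‖ₑ ^ 2 ≤ C)
    {u v : ℝ → EuclideanSpace ℝ (Fin 3) → EuclideanSpace ℝ (Fin 3)}
    {p q : ℝ → EuclideanSpace ℝ (Fin 3) → ℝ}
    (hu : IsClassicalNSSolutionOn (Icc 0 T) ν f u p) (hv : IsClassicalNSSolutionOn (Icc 0 T) ν f v q)
    (h₀ : ∀ j ≤ 1, ∫⁻ x, ‖iteratedFDeriv ℝ j (u 0) x‖ₑ ^ 2 < ⊤) (hdatum : v 0 = u 0)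
    (huE : ∃ C : ℝ≥0, ∀ t ∈ Icc 0 T, ∫⁻ x, ‖u t x‖ₑ ^ 2 ≤ C)
    (hvE : ∃ C : ℝ≥0, ∀ t ∈ Icc 0 T, ∫⁻ x, ‖v t x‖ₑ ^ 2 ≤ C)
    (hup : HasForcedNormalisedPressure u f p (Icc 0 T))
    (hvq : HasForcedNormalisedPressure v f q (Icc 0 T)) :
    (∀ t ∈ Icc 0 T, v t = u t) ∧ ∀ t ∈ Icc 0 T, q t = p t :=
  tao2011_forced_unconditionalUniqueness_of_velocity tao2011_forced_unconditionalUniqueness_velocity_holds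
    hν hT hf hfH1 hu hv h₀ hdatum huE hvE hup hvq

end Uniqueness

end Literature.Analysis.FluidPDE

end
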